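import Summits.CriticalPhenomena.PercolationContinuityZ3.Theorems.PercNearOneGluingNoHeavyLowerTailKnQuestion8CoefficientwiseGluing
import HarnessLib

/-!
# Cluster bookkeeping for subdividing an edge (`e = {u,v}` ↦ path `u–m–v`)

Support file (`--supports stmt-CriticalPhenomena-4575`, closed), prover `prim-lf-2` (gen 26).  No definitions, no named facts, no sorries; standard axioms.
Memo `prim-lf-2/CW-REDUCTION-gen26.md` §2; used by `…CoefficientwiseSubdivision.lean` (SUBDIVISION LEMMA).

* `Coefficientwise.mem_openCluster_insert_pendantEdge` — adding an edge `h = {w, m}` with `m` new: `C_x(t ∪ {h}) = C_x(t) ∪ [w ∈ C_x t]·{m}`.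
* `Coefficientwise.mem_openCluster_insert_halves` — both halves red: `C_x(t ∪ {h₁,h₂}) = C_x(t ∪ {e}) ∪ [u ∈ C_x(t ∪ {e})]·{m}`.
[cite: KozmaNitzan2024, Questions 8–9 (§5.5 p. 36) (context: first rung of the coefficientwise programme for Question 8)]
-/

namespace Summit.CriticalPhenomena.PercolationContinuityZ3.Theorems

open Finset Literature.Probability.Percolation

namespace Coefficientwise

variable {ι V : Type*} [DecidableEq ι]

/-- Adding an edge `h = {w, m}` whose end `m ≠ x` meets no edge of `t`: the red cluster of `x` for `t ∪ {h}` is `C_x(t)`, plus `m` if `w ∈ C_x(t)`.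
[cite: KozmaNitzan2024, §5.5 (context only; folklore)] -/
theorem mem_openCluster_insert_pendantEdge (ends : ι → Sym2 V) {t : Finset ι} {h : ι} {w m x : V}
    (hh : ends h = s(w, m)) (hwm : w ≠ m) (hmt : ∀ i ∈ t, m ∉ ends i) (hxm : x ≠ m) (y : V) :
    y ∈ openCluster (ends '' (↑(insert h t) : Set ι)) x ↔
      y ∈ openCluster (ends '' (↑t : Set ι)) x ∨ (w ∈ openCluster (ends '' (↑t : Set ι)) x ∧ y = m) := by
  have hglue := mem_openCluster_union_glue ends (s₁ := t) (s₂ := {h}) (v := w) (x := x)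
    (fun i hi i' hi' y' hyi hyi' => by
      rw [Finset.mem_singleton] at hi'; subst hi'
      rw [hh, Sym2.mem_iff] at hyi'
      rcases hyi' with rfl | rfl
      · rfl
      · exact absurd hyi (hmt i hi))
    (fun i' hi' hx => by
      rw [Finset.mem_singleton] at hi'; subst hi'
      rw [hh, Sym2.mem_iff] at hx
      rcases hx with rfl | rfl
      · rfl
      · exact absurd rfl hxm) y
  rw [Finset.insert_eq, Finset.union_comm, hglue]
  -- the red cluster of `w` for the single edge `h` is `{w, m}`
  have hsingle : y ∈ openCluster (ends '' (↑({h} : Finset ι) : Set ι)) w ↔ y = w ∨ y = m := by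
    constructor
    · intro hy
      by_cases hyw : y = w
      · exact Or.inl hyw
      · obtain ⟨i, hi, hyi⟩ := exists_edge_of_mem_openCluster ends hy hyw
        rw [Finset.mem_singleton] at hi; subst hi
        rw [hh, Sym2.mem_iff] at hyi
        exact hyi
    · rintro (rfl | rfl)
      · exact mem_openCluster_self _ _
      · have hadj : (openGraph (ends '' (↑({h} : Finset ι) : Set ι))).Adj w y := by
          rw [openGraph_image_adj]; exact ⟨⟨h, Finset.mem_singleton_self h, hh⟩, hwm⟩
        exact hadj.reachable
  rw [hsingle]
  constructor
  · rintro (hy | ⟨hw, rfl | rfl⟩)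
    · exact Or.inl hy
    · exact Or.inl hw
    · exact Or.inr ⟨hw, rfl⟩
  · rintro (hy | ⟨hw, rfl⟩)
    · exact Or.inl hy
    · exact Or.inr ⟨hw, Or.inr rfl⟩

/-- Both halves red: for `t ∌ e` with `m` meeting no edge of `t`, the red cluster of `x ≠ m` for `t ∪ {h₁, h₂}` (`h₁ = {u,m}`, `h₂ = {m,v}`) is the red cluster
for `t ∪ {e}` (`e = {u,v}`), plus `m` if that cluster contains `u`.  [cite: KozmaNitzan2024, §5.5 (context only; folklore)] -/
theorem mem_openCluster_insert_halves (ends : ι → Sym2 V) {t : Finset ι} {e h₁ h₂ : ι} {u v m x : V}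
    (he : ends e = s(u, v)) (hh₁ : ends h₁ = s(u, m)) (hh₂ : ends h₂ = s(m, v)) (huv : u ≠ v) (hum : u ≠ m) (hvm : v ≠ m)
    (hmt : ∀ i ∈ t, m ∉ ends i) (hxm : x ≠ m) (y : V) :
    y ∈ openCluster (ends '' (↑(insert h₁ (insert h₂ t)) : Set ι)) x ↔
      y ∈ openCluster (ends '' (↑(insert e t) : Set ι)) x ∨ (u ∈ openCluster (ends '' (↑(insert e t) : Set ι)) x ∧ y = m) := by
  set G₁ := openGraph (ends '' (↑(insert h₁ (insert h₂ t)) : Set ι)) with hG₁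
  set G₂ := openGraph (ends '' (↑(insert e t) : Set ι)) with hG₂
  have adj1_um : G₁.Adj u m := by
    rw [hG₁, openGraph_image_adj]; exact ⟨⟨h₁, by simp, hh₁⟩, hum⟩
  have adj1_mv : G₁.Adj m v := by
    rw [hG₁, openGraph_image_adj]; exact ⟨⟨h₂, by simp, hh₂⟩, hvm.symm⟩
  have adj2_uv : G₂.Adj u v := by
    rw [hG₂, openGraph_image_adj]; exact ⟨⟨e, by simp, he⟩, huv⟩
  have adj_t1 : ∀ {a b : V} {i : ι}, i ∈ t → ends i = s(a, b) → a ≠ b → G₁.Adj a b := fun hi hab hne => by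
    rw [hG₁, openGraph_image_adj]; exact ⟨⟨_, by simp [hi], hab⟩, hne⟩
  have adj_t2 : ∀ {a b : V} {i : ι}, i ∈ t → ends i = s(a, b) → a ≠ b → G₂.Adj a b := fun hi hab hne => by
    rw [hG₂, openGraph_image_adj]; exact ⟨⟨_, by simp [hi], hab⟩, hne⟩
  -- `m` is not in any red cluster of `x` built from `t ∪ {e}`
  have hm2 : ¬ G₂.Reachable x m := by
    intro hxm'
    obtain ⟨i', hi', hmi'⟩ := exists_edge_of_mem_openCluster ends (s := insert e t) (a := x) (y := m) hxm' hxm.symm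
    rcases Finset.mem_insert.mp hi' with hi'e | hi't
    · rw [hi'e, he, Sym2.mem_iff] at hmi'
      rcases hmi' with h' | h'
      · exact hum h'.symm
      · exact hvm h'.symm
    · exact hmt i' hi't hmi'
  -- lifting `G₂`-reachability to `G₁` (replace the edge `e` by the path `u–m–v`)
  have lift : ∀ y' : V, G₂.Reachable x y' → G₁.Reachable x y' := by
    intro y' hy
    rw [SimpleGraph.reachable_iff_reflTransGen] at hy
    induction hy with
    | refl => exact SimpleGraph.Reachable.rfl
    | @tail b c _ hbc ih =>
      have hbc' := hbc
      rw [hG₂, openGraph_image_adj] at hbc'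
      obtain ⟨⟨i, hi, hiends⟩, hne⟩ := hbc'
      rcases Finset.mem_insert.mp hi with hie | hit
      · have hbc2 : s(b, c) = s(u, v) := hiends.symm.trans (hie ▸ he)
        rcases Sym2.eq_iff.mp hbc2 with ⟨hb, hc⟩ | ⟨hb, hc⟩
        · rw [hc]; rw [hb] at ih
          exact (ih.trans adj1_um.reachable).trans adj1_mv.reachable
        · rw [hc]; rw [hb] at ih
          exact (ih.trans adj1_mv.symm.reachable).trans adj1_um.symm.reachable
      · exact ih.trans (adj_t1 hit hiends hne).reachable
  constructor
  · intro hy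
    change G₁.Reachable x y at hy
    rw [SimpleGraph.reachable_iff_reflTransGen] at hy
    change G₂.Reachable x y ∨ (G₂.Reachable x u ∧ y = m)
    induction hy with
    | refl => exact Or.inl SimpleGraph.Reachable.rfl
    | @tail b c _ hbc ih =>
      have hbc' := hbc
      rw [hG₁, openGraph_image_adj] at hbc'
      obtain ⟨⟨i, hi, hiends⟩, hne⟩ := hbc'
      simp only [Finset.mem_insert] at hi
      rcases hi with hi1 | hi2 | hit
      · -- step along `h₁ = {u, m}`
        have hbc2 : s(b, c) = s(u, m) := hiends.symm.trans (hi1 ▸ hh₁)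
        rcases Sym2.eq_iff.mp hbc2 with ⟨hb, hc⟩ | ⟨hb, hc⟩
        · rcases ih with hxb | ⟨_, hbm⟩
          · exact Or.inr ⟨hb ▸ hxb, hc⟩
          · exact absurd (hb.symm.trans hbm) hum
        · rcases ih with hxb | ⟨hxu, _⟩
          · exact absurd (hb ▸ hxb) hm2
          · exact Or.inl (hc ▸ hxu)
      · -- step along `h₂ = {m, v}`
        have hbc2 : s(b, c) = s(m, v) := hiends.symm.trans (hi2 ▸ hh₂)
        rcases Sym2.eq_iff.mp hbc2 with ⟨hb, hc⟩ | ⟨hb, hc⟩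
        · rcases ih with hxb | ⟨hxu, _⟩
          · exact absurd (hb ▸ hxb) hm2
          · exact Or.inl (hc ▸ hxu.trans adj2_uv.reachable)
        · rcases ih with hxb | ⟨_, hbm⟩
          · exact Or.inr ⟨(hb ▸ hxb).trans adj2_uv.symm.reachable, hc⟩
          · exact absurd (hb.symm.trans hbm) hvm
      · -- step along an edge of `t`
        rcases ih with hxb | ⟨_, hbm⟩
        · exact Or.inl (hxb.trans (adj_t2 hit hiends hne).reachable)
        · exfalso
          exact hmt i hit (by rw [hiends, hbm]; exact Sym2.mem_mk_left _ _)
  · rintro (hy | ⟨hu, hym⟩)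
    · exact lift y hy
    · rw [hym]
      exact (lift u hu).trans adj1_um.reachable

end Coefficientwise

end Summit.CriticalPhenomena.PercolationContinuityZ3.Theorems
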